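/-
Origin: expansion seat `planner-pub-hodgecm-mc-axioms-1-g14-0`, handover #W209 2026-08-20T15:53:55Z md5 50d153acb8cb (PKG 419bb32a3888 → 50d153acb8cb; 106 l.; MECHANICAL (iib-R) rewrite v3.1 of the PKG file as it stands (17 token edits; rules R1x1+RX[h₂]x16)) (`HOME/mc/pub-hodgecm-mc-axioms-1-g14/revendor/kit-r55/stage55/HodgeCM/Model/Binders/Gen12SeesawOp.lean`, md5 50d153acb8cb, 106 lines);
landed by the gen-22 packager (p-g22) in gate run 55 REPLACES the earlier landed copy of `HodgeCM/Model/Binders/Gen12SeesawOp.lean` (seat copy carried the packager Origin header of an earlier run (stripped)).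
-/
/-
Origin: speedrun cell pub-hodgecm, MODEL-CONSTRUCTION sub-cell, unit pub-hodgecm-mc-binder-1-g7 (BINDER PROVER, gen 7; node
B2-meet, BINDER-OWNERS row 14, clause (SS) of RECORD 2′ and the export shape (x-S) of BINDER-TRIAGE §63.2), seat
prover-pub-hodgecm-mc-binder-1-g7-0, 2026-08-19 (″ (adm) re-cut the same day: `SeesawCore … adm`).
Target in PKG: HodgeCM/Model/Binders/Gen12SeesawOp.lean (NEW additive leaf; imports kit #9 `Model/Binders/Gen12CharMem` only; nothing
landed imports it).  KERNEL ONLY: 0 records of published theorems, nothing cited, 0 `def … : Prop`, MODEL-N ±0.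
-/
import Summits.HodgeConjecture.HodgeCM.Model.Binders.Gen12CharMem

/-!
# (SS) from the OPERATOR-level see-saw restriction — the export shape (x-S)

RECORD 2′ `SeesawCore = {τ, seesaw (SS), wedge_mem (SS-K)}` (`Binders/Gen12CharMem`) states (SS) at Θ-VALUES:
`Θ_W(W.ρ(eV g, eW (jT₁₂ t)) (τ φ₁ φ₂)) = Θ₃(P₀.ω(g, t₁) φ₁) · Θ₃(P₁.ω(g, t₂) φ₂)`.  The (S-restr) producer (period-1 lineage,
`Model/ArchSideTerm` / `P_eq_restrict`, RUN 37) DEFINES the small pair data `(S V c).P k` by restricting the W-block representation, so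
its natural primary statement is the OPERATOR-level restriction

  (x-S) `op : W.ρ(eV g, eW (jT₁₂ t)) (τ φ₁ φ₂) = τ (P₀.ω(g, t₁) φ₁) (P₁.ω(g, t₂) φ₂)`     (`τ` BILINEAR),

(tree #23 `pairRep_blockDiag_seesawTensor` at the data of record, with the (S-restr) twists absorbed into `P₀.ω`, `P₁.ω`), together
with the product rule for theta values of the pairing

  `prod : Θ_W (τ φ₁ φ₂) = Θ₃ φ₁ · Θ₃ φ₂`     (tree #21/#22 `IsSeesawProduct`, `isSeesawProduct_seesawTensor`: the lattice sum of a
  pure tensor factors).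

This leaf records that shape: **`SeesawCore.ofOp τ prod op wedge_mem`** builds RECORD 2′ ((SS) := `op` then `prod`), and
**`op_one`** is the `t = 1` instance `W.ρ(eV g, 1) (τ φ₁ φ₂) = τ (P₀.ω(g, 1) φ₁) (P₁.ω(g, 1) φ₂)` consumed by the (SS-K) junction
(tree #28 `wedgePair_mem_kappaIsotypic`'s hypothesis `hres` along `K_∞`).  Nothing here is a claim of the manuscripts under adjudication.
-/

set_option autoImplicit false

noncomputable section

open MeasureTheory NumberField

namespace HodgeCM.Model

open HodgeCM HodgeCM.Universe
open Literature.NumberTheory.Weil1964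
open Literature.NumberTheory.Automorphic (piSchwartzBruhat)
open Literature.AlgebraicGeometry.HodgeTheory
open Literature.NumberTheory.Automorphic.PicardCM
open Literature.NumberTheory.Transcendental (Arapura2012_Cor_15_4_6)
open HodgeCM.Model.ThetaSpace

variable (hHD : exists_isReal_hodgeModel) (hI : hodgePQ_independent_of_hodgeModel)
  (h₁ : BallQuotientUniformised)  (h₃ : CMAbelianVarietyRealised)
variable (W : ∀ {L : CMField} {ι₁ : L →+* ℂ} (V : HermSpace3 L ι₁) (c : SeesawCtx L), WmInput V c.D)
  (S : ∀ {L : CMField} {ι₁ : L →+* ℂ} (V : HermSpace3 L ι₁) (c : SeesawCtx L), ThetaAdelicSide V c)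
variable {L : CMField} {ι₁ : L →+* ℂ} (V : HermSpace3 L ι₁) (c : SeesawCtx L) (hV : IsAnisotropic L V.Hm)

local notation3 "L⁺" => maximalRealSubfield (L : Type)

/- the ADMISSIBILITY predicate on `K`-type situations (`Gen12Residual.Adm`) -/
variable (adm : ∀ (Γ : Level V) (k : Fin 4),
    KTypeSituation ((pinX hHD hI h₁ h₃ S V c hV).P k) ((pinX hHD hI h₁ h₃ S V c hV).ιinf Γ)
      ((pinX hHD hI h₁ h₃ S V c hV).Δ Γ) (pinX hHD hI h₁ h₃ S V c hV).κ₁ (pinX hHD hI h₁ h₃ S V c hV).τ₁ → Prop)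

/-- **RECORD 2′ from the operator-level restriction (x-S).**  A BILINEAR pairing `τ` of small test functions into the W-block's
Schwartz–Bruhat space whose theta values multiply (`prod`) and on which `W.ρ(eV g, eW (jT₁₂ t))` restricts ON THE NOSE to the two
small pair actions (`op`) gives the Θ-value clause (SS); (SS-K) is carried through. -/
def SeesawCore.ofOp
    (τ : piSchwartzBruhat L⁺ (Fin 3) →ₗ[ℂ] piSchwartzBruhat L⁺ (Fin 3) →ₗ[ℂ] piSchwartzBruhat (W V c).F (W V c).ι)
    (prod : ∀ φ₁ φ₂ : piSchwartzBruhat L⁺ (Fin 3),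
      thetaDistLM (W V c).F (W V c).ι (τ φ₁ φ₂) = thetaDistLM L⁺ (Fin 3) φ₁ * thetaDistLM L⁺ (Fin 3) φ₂)
    (op : ∀ (g : ↥(Adelic.regimeSubgroup L V.Hm)) (t : SeesawTorus L⁺ L) (φ₁ φ₂ : piSchwartzBruhat L⁺ (Fin 3)),
      (((W V c).ρ ((W V c).eV (g : ↥(Adelic.adelicUnitaryGroup L V.Hm)), (W V c).eW (c.D.jT₁₂ t))) :
          Module.End ℂ (piSchwartzBruhat (W V c).F (W V c).ι)) (τ φ₁ φ₂) =
        τ (((S V c).P 0).ω (g, SeesawTorus.fst L⁺ L t) φ₁) (((S V c).P 1).ω (g, SeesawTorus.snd L⁺ L t) φ₂))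
    (wedge_mem : ∀ (Γ : Level V)
      (Sit₀ : KTypeSituation ((pinX hHD hI h₁ h₃ S V c hV).P 0) ((pinX hHD hI h₁ h₃ S V c hV).ιinf Γ)
        ((pinX hHD hI h₁ h₃ S V c hV).Δ Γ) (pinX hHD hI h₁ h₃ S V c hV).κ₁ (pinX hHD hI h₁ h₃ S V c hV).τ₁)
      (Sit₁ : KTypeSituation ((pinX hHD hI h₁ h₃ S V c hV).P 1) ((pinX hHD hI h₁ h₃ S V c hV).ιinf Γ)
        ((pinX hHD hI h₁ h₃ S V c hV).Δ Γ) (pinX hHD hI h₁ h₃ S V c hV).κ₁ (pinX hHD hI h₁ h₃ S V c hV).τ₁),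
      adm Γ 0 Sit₀ → adm Γ 1 Sit₁ → ∀ j₀ ∈ Sit₀.𝓙, ∀ j₁ ∈ Sit₁.𝓙,
        τ (j₀.1 (Sit₀.ι (LinearMap.proj 0))) (j₁.1 (Sit₁.ι (LinearMap.proj 1))) -
          τ (j₀.1 (Sit₀.ι (LinearMap.proj 1))) (j₁.1 (Sit₁.ι (LinearMap.proj 0))) ∈ (W V c).SK) :
    SeesawCore hHD hI h₁ h₃ W S V c hV adm where
  τ φ₁ φ₂ := τ φ₁ φ₂
  seesaw g t φ₁ φ₂ := by rw [op, prod]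
  wedge_mem := wedge_mem

/-- **(x-S) at `t = 1`** — the shape consumed along `K_∞` by the (SS-K) junction (tree #28 `wedgePair_mem_kappaIsotypic`, hypothesis
`hres`): `W.ρ(eV g, 1) (τ φ₁ φ₂) = τ (P₀.ω(g, 1) φ₁) (P₁.ω(g, 1) φ₂)`. -/
theorem op_one
    (τ : piSchwartzBruhat L⁺ (Fin 3) →ₗ[ℂ] piSchwartzBruhat L⁺ (Fin 3) →ₗ[ℂ] piSchwartzBruhat (W V c).F (W V c).ι)
    (op : ∀ (g : ↥(Adelic.regimeSubgroup L V.Hm)) (t : SeesawTorus L⁺ L) (φ₁ φ₂ : piSchwartzBruhat L⁺ (Fin 3)),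
      (((W V c).ρ ((W V c).eV (g : ↥(Adelic.adelicUnitaryGroup L V.Hm)), (W V c).eW (c.D.jT₁₂ t))) :
          Module.End ℂ (piSchwartzBruhat (W V c).F (W V c).ι)) (τ φ₁ φ₂) =
        τ (((S V c).P 0).ω (g, SeesawTorus.fst L⁺ L t) φ₁) (((S V c).P 1).ω (g, SeesawTorus.snd L⁺ L t) φ₂))
    (g : ↥(Adelic.regimeSubgroup L V.Hm)) (φ₁ φ₂ : piSchwartzBruhat L⁺ (Fin 3)) :
    (((W V c).ρ ((W V c).eV (g : ↥(Adelic.adelicUnitaryGroup L V.Hm)), 1)) :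
        Module.End ℂ (piSchwartzBruhat (W V c).F (W V c).ι)) (τ φ₁ φ₂) =
      τ (((S V c).P 0).ω (g, 1) φ₁) (((S V c).P 1).ω (g, 1) φ₂) := by
  have hop := op g 1 φ₁ φ₂
  simp only [map_one] at hop
  convert hop using 4 <;> rfl

end HodgeCM.Model

end
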